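import Summits.QuantumFields.YangMills.Theorems.FluctuationComparisonRegPrIntLS2BetaChartReadDerivKStepEllOne
import Summits.QuantumFields.YangMills.Theorems.UnitScaleTiltProp7CovMeanTowerOnto
import HarnessLib

/-!
# S2β · AVG₂♭-ax_q route, brick (P′) part 3 — «(D2-ℓ¹)»: WHAT `DM` DOES, k STEPS, IN `ℓ¹` OVER BONDS — NO `L^k`:
# `Σ_B ‖↑((DΨ_k(0) X) B)‖ ≤ (1 + 8d(d+2)L)·exp((844d(d+2)L + 6464d²((d+2)L)²)·Σ_{i<k} α_i)·Σ_b ‖↑(X b)‖` — the bootstrap of ✓p826096 (D2) re-run in `ℓ¹`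

Cell `ym3-torus` (YM ladder rung R3 = continuum `SU(2)` Yang–Mills on the three-torus at fixed lattice data — a RUNG: NOT d = 4, NOT infinite volume,
NOT a mass gap, NOT Clay).  Width seat «width 20» `ym3-torus-px20` (gen 23), FREE px helper on crux `stmt-QuantumFields-20520`
(`…Theses.UnitScaleTilt.FluctuationComparisonRegPrIntL`), LINE g18-1 S2β, pairing lane; AVG₂♭-ax_q ⟸ `hLoc` (px16 g22 `…S2BetaTaylorOfLocal`): the k-step second-order remainder of
the quaternion read telescopes (Q7 ✓p827759) into one-step brackets PROPAGATED by `DMq_{J←J+t} = DΨ_t(0)`; ✓p826096 (D2) bounds that propagation sup → sup with the constant-field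
growth `L` per step, which overshoots the letter's purse by `N²` (UV3-NODE §89.4).  THIS FILE: the same bootstrap in `ℓ¹` over bonds, over part 2's one-step decomposition
✓∕⧗`…ChartReadDerivKStepEllOne.decomp_step_ell1`: the transfer matrix `[[L^{1−d} + O(α), O(α)],[(d+2)L, 1]]` is POWER-BOUNDED (the gauge part is carried by restriction), so the
weighted size `‖M_i‖₁ + κ‖Φ_i‖₁`, `κ = 1∕(4(d+2)L)`, grows by at most `(1 + c·α_i)` per level, `c = 844d(d+2)L + 6464d²((d+2)L)²` — depth-free under `Σα` alone, no extra
smallness of `α`.  `--kind proof --supports stmt-QuantumFields-20520 --as helper`, count-neutral, DEFINITION-FREE (0 `def`, 0 `instance`, 0 `notation`, 0 `sorry`), default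
heartbeats; generic `P : Params` with `2 ≤ d`, `SU(N)`, `k ≤ m + K`.

WHAT IS PROVED (sorry-free).
* §4 ★★`exists_decomp_fderiv_chartRead_iter_ell1` — for every `i ≤ k`: `↑(DΨ_i(0)X) = M_i + D_{V_i}Φ_i` with **`‖M_i‖₁ + κ·‖Φ_i‖₁ ≤ Π_{j<i}(1 + c·α_j)·‖X‖₁`** ((D0) chain rule
  ✓`fderiv_chartRead_iter_succ_apply`, (D1-loc) ✓`norm_fderiv_chartRead_sub_covLinAvgR0_le_local`, part 2's step; run factor `(d!)²L∕|I| = L^{1−d} ≤ 1∕2`).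
* §5 ★★★`sum_norm_fderiv_chartRead_iter_le` — **`Σ_B ‖↑((DΨ_k(0) X) B)‖ ≤ (1 + 8d(d+2)L)·Π_{i<k}(1 + c·α_i)·Σ_b ‖↑(X b)‖`**; ★★★`sum_norm_fderiv_chartRead_iter_le_exp` — the same with
  `exp(c·Σ_{i<k}α_i)` (lit-free: ✓`prod_one_add_le_exp_sum`): the (P′) letter «`ℓ¹ → ℓ¹` propagation WITHOUT `L^k`».

HONEST SCOPE.  Real-analysis bookkeeping over (D0)(D1-loc) and part 2; constants crude but free of `k`, of the volume and of any power of `L^k`; nothing of Bałaban's renormalisation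
analysis is asserted or proved beyond the printed Prop. 3 already in the tree ([Balaban1985Averaging] (139)–(147) bound the AXIAL-gauge operator in the scaled sup norm — this is
the tree's (0.4) reading in `ℓ¹`); the one-step bracket bound in curl currency, the tower budget of the stage chords, `hLoc`, AVG₂♭-ax_q, «MULT♭-ax»∕«CRIT-ax», (D-ax), GAP♯∘
(`stub_uniformFibreGapOrbit`; registry UNTOUCHED), the five REGISTERED stubs, S2β, crux 20520, 19936, 19200 and `YM3TorusSU2` are NOT proved; no summit statement is proved by a
helper; rung R3 = SU(2) YM₃ on T³ at fixed lattice data — NOT d = 4, NOT infinite volume, NOT a mass gap, NOT Clay; the Yang–Mills mass gap is NOT proved.  Axioms standard.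

References: T. Bałaban, CMP **98** (1985) 17–51 [Balaban1985Averaging] (Prop. 3 (121)–(126) p.36, Prop. 4 p.37, (139)–(147) pp.39–40); CMP **109** (1987) 249–301 [Balaban1987RG1]
((0.3)–(0.4), (0.11) pp.252–253).
-/

set_option autoImplicit false

noncomputable section

open scoped BigOperators Matrix.Norms.L2Operator Topology
open Filter Set Function

namespace Summit.QuantumFields.YangMills.Theorems.FluctuationComparisonRegPrIntLS2BetaChartReadDerivKStepEllOneTower

open Literature.MathematicalPhysics.QuantumFieldTheory.Balaban1983to89
open Literature.MathematicalPhysics.QuantumFieldTheory.Balaban1983to89.T4Continuum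
open Literature.MathematicalPhysics.QuantumFieldTheory.Balaban1983to89.HaarExponentialChart
open Literature.MathematicalPhysics.QuantumFieldTheory.Balaban1983to89.HaarExponentialChart.IsChartRep
open Literature.MathematicalPhysics.QuantumFieldTheory.Balaban1983to89.BlockAveraging
open Literature.MathematicalPhysics.QuantumFieldTheory.Balaban1983to89.AveragingRT
open Literature.MathematicalPhysics.QuantumFieldTheory.Balaban1983to89.ExpMeanLog (expMeanLogSU deltaSU)
open Literature.MathematicalPhysics.QuantumFieldTheory.Balaban1983to89.Node00
open Literature.MathematicalPhysics.QuantumFieldTheory.Balaban1983to89.BlockAveragingEMLLinearisedBackground (covLinAvgR0)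
open Summit.QuantumFields.YangMills.BalabanUVNodes.N09ChartReadAveragingSmooth
open Summit.QuantumFields.YangMills.Theorems.FluctuationComparisonRegPrIntLS2BetaChartReadDescentChainRule (fderiv_chartRead_iter_succ_apply fderiv_chartRead_iter_zero)
open Summit.QuantumFields.YangMills.Theorems.FluctuationComparisonRegPrIntLS2BetaChartReadDerivKStepSup (one_le_prod_one_add prod_one_add_le_exp_sum)
open Summit.QuantumFields.YangMills.Theorems.FluctuationComparisonRegPrIntLS2BetaChartReadDerivLocal (norm_fderiv_chartRead_sub_covLinAvgR0_le_local)
open Summit.QuantumFields.YangMills.Theorems.Prop7CovMeanTowerOnto (card_idx)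
open Summit.QuantumFields.YangMills.Theorems.FluctuationComparisonRegPrIntLS2BetaChartReadDerivKStepEllOne
  (norm_truncate_le_sum sum_norm_le_of_decomp decomp_step_ell1)

variable {P : Params} {N : ℕ} [NeZero N]

/-! ## §4 The bootstrap along the levels, in `ℓ¹` -/

section Bootstrap

/-- ★★ **THE `ℓ¹` BOOTSTRAP**: `2 ≤ d`, `k ≤ m + K`, loop `α_i`-guards at every level `i < k` (`0 ≤ α_i ≤ 1∕24`, `α_i < δ_N`).  For every `i ≤ k` the level-`i` derivative field
`Y_i = ↑(DΨ_i(0)X)` splits as `M_i + D_{V_i}Φ_i` with **`‖M_i‖₁ + κ·‖Φ_i‖₁ ≤ Π_{j<i}(1 + c·α_j)·‖X‖₁`**, `κ = 1∕(4(d+2)L)`, `c = 844·d·(d+2)L + 6464·d²·((d+2)L)²`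
(`‖·‖₁` = sum of the matrix norms over bonds ∕ sites). [cite: Balaban1985Averaging, Prop. 3 (124)-(126) p.36, (139)-(147) pp.39-40; Balaban1987RG1, (0.11) p.253] -/
theorem exists_decomp_fderiv_chartRead_iter_ell1 (hd : 2 ≤ P.d) (U₀ : GaugeField P 0 (SU N)) (X : PBond P 0 → (specialUnitaryLogChart (Fin N)).lie) {α : ℕ → ℝ}
    (hα0 : ∀ i, 0 ≤ α i) (hα24 : ∀ i, α i ≤ 1 / 24) (hαδ : ∀ i, α i < deltaSU (Fin N)) (k : ℕ) (hk : k ≤ P.m + P.K)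
    (hα : ∀ i, i < k → ∀ (c : PBond P (i + 1)) (idx : Idx P),
      dist1 (loopHol (Averaging.iter (fun i => blockAvg (P := P) (j := i) (expMeanLogSU (n := Fin N))) i U₀) c idx) ≤ α i) :
    ∀ i, i ≤ k → ∃ (M : PBond P i → Matrix (Fin N) (Fin N) ℂ) (Φ : Site P i → Matrix (Fin N) (Fin N) ℂ),
      (∀ b : PBond P i,
        ((fderiv ℝ (fun (A : PBond P 0 → (specialUnitaryLogChart (Fin N)).lie) (c : PBond P i) =>
            (isChartRep_specialUnitaryGroup (n := Fin N)).logChart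
              (Averaging.iter (fun i => blockAvg (P := P) (j := i) (expMeanLogSU (n := Fin N))) i
                  (fun b => (isChartRep_specialUnitaryGroup (n := Fin N)).expChart (A b) * U₀ b) c *
                (Averaging.iter (fun i => blockAvg (P := P) (j := i) (expMeanLogSU (n := Fin N))) i U₀ c)⁻¹)) 0 X b :
            (specialUnitaryLogChart (Fin N)).lie) : Matrix (Fin N) (Fin N) ℂ) =
          M b + (Φ b.src - ((Averaging.iter (fun i => blockAvg (P := P) (j := i) (expMeanLogSU (n := Fin N))) i U₀ b : SU N) : Matrix (Fin N) (Fin N) ℂ) *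
            Φ b.tgt * star ((Averaging.iter (fun i => blockAvg (P := P) (j := i) (expMeanLogSU (n := Fin N))) i U₀ b : SU N) : Matrix (Fin N) (Fin N) ℂ))) ∧
      ∑ b : PBond P i, ‖M b‖ + (1 / (4 * (((P.d + 2) * P.L : ℕ) : ℝ))) * ∑ x : Site P i, ‖Φ x‖ ≤
        (∏ j ∈ Finset.range i, (1 + (844 * (P.d : ℝ) * (((P.d + 2) * P.L : ℕ) : ℝ) + 6464 * (P.d : ℝ) ^ 2 * (((P.d + 2) * P.L : ℕ) : ℝ) ^ 2) * α j)) *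
          ∑ b : PBond P 0, ‖((X b : (specialUnitaryLogChart (Fin N)).lie) : Matrix (Fin N) (Fin N) ℂ)‖ := by
  classical
  -- letters
  set ℓ : ℝ := (((P.d + 2) * P.L : ℕ) : ℝ) with hℓ
  set D : ℝ := (P.d : ℝ) with hD
  set κ : ℝ := 1 / (4 * ℓ) with hκ
  set c : ℝ := 844 * D * ℓ + 6464 * D ^ 2 * ℓ ^ 2 with hc
  set E : ℕ → ℝ := fun i => ∏ j ∈ Finset.range i, (1 + c * α j) with hE
  set x₀ : ℝ := ∑ b : PBond P 0, ‖((X b : (specialUnitaryLogChart (Fin N)).lie) : Matrix (Fin N) (Fin N) ℂ)‖ with hx₀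
  have hL2 : 2 ≤ P.L := P.hL.2
  have hL2r : (2 : ℝ) ≤ (P.L : ℝ) := by exact_mod_cast hL2
  have hD2 : (2 : ℝ) ≤ D := by rw [hD]; exact_mod_cast hd
  have hD0 : 0 ≤ D := by linarith
  have hℓ1 : (1 : ℝ) ≤ ℓ := by
    rw [hℓ]; push_cast; nlinarith
  have hℓ0 : 0 < ℓ := by linarith
  have hκ0 : 0 < κ := by rw [hκ]; positivity
  have hc0 : 0 ≤ c := by rw [hc]; positivity
  have hx₀0 : 0 ≤ x₀ := Finset.sum_nonneg fun _ _ => norm_nonneg _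
  have hE1 : ∀ i, 1 ≤ E i := fun i => one_le_prod_one_add hc0 hα0 i
  -- the run factor `ρ = (d!)²L∕|I| ≤ 1∕2`
  set ρ : ℝ := ((Fintype.card (Equiv.Perm (Fin P.d)) * Fintype.card (Equiv.Perm (Fin P.d)) : ℕ) : ℝ) * (P.L : ℝ) / (Fintype.card (Idx P) : ℝ) with hρ
  have hρle : ρ ≤ 1 / 2 := by
    have hI : (Fintype.card (Idx P) : ℝ) = (P.L : ℝ) ^ P.d * ((Fintype.card (Equiv.Perm (Fin P.d)) * Fintype.card (Equiv.Perm (Fin P.d)) : ℕ) : ℝ) := by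
      rw [card_idx]; push_cast; ring
    have hcP : (1 : ℝ) ≤ ((Fintype.card (Equiv.Perm (Fin P.d)) * Fintype.card (Equiv.Perm (Fin P.d)) : ℕ) : ℝ) := by
      have : 1 ≤ Fintype.card (Equiv.Perm (Fin P.d)) * Fintype.card (Equiv.Perm (Fin P.d)) := Nat.one_le_iff_ne_zero.2 (by positivity)
      exact_mod_cast this
    have hpow : 2 * (P.L : ℝ) ≤ (P.L : ℝ) ^ P.d := by
      calc 2 * (P.L : ℝ) ≤ (P.L : ℝ) * (P.L : ℝ) := mul_le_mul_of_nonneg_right hL2r (by positivity)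
        _ = (P.L : ℝ) ^ 2 := by ring
        _ ≤ (P.L : ℝ) ^ P.d := pow_le_pow_right₀ (by linarith) hd
    rw [hρ, hI, div_le_iff₀ (by positivity)]
    nlinarith
  have hρ0 : 0 ≤ ρ := by rw [hρ]; positivity
  intro i
  induction i with
  | zero =>
    intro _
    refine ⟨fun b => ((X b : (specialUnitaryLogChart (Fin N)).lie) : Matrix (Fin N) (Fin N) ℂ), 0, fun b => ?_, ?_⟩
    · rw [fderiv_chartRead_iter_zero (P := P) (N := N) U₀]
      simp
    · show ∑ b : PBond P 0, ‖((X b : (specialUnitaryLogChart (Fin N)).lie) : Matrix (Fin N) (Fin N) ℂ)‖ + κ * ∑ x : Site P 0, ‖(0 : Site P 0 → Matrix (Fin N) (Fin N) ℂ) x‖ ≤ E 0 * x₀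
      rw [hE]; simp [hx₀]
  | succ i ih =>
    intro hik
    have hi : i < k := Nat.lt_of_succ_le hik
    have hi1 : i + 1 ≤ P.m + P.K := hik.trans hk
    obtain ⟨M, Φ, hdec, hS⟩ := ih hi.le
    -- guards at level `i`
    have hαi : ∀ (c : PBond P (i + 1)) (idx : Idx P),
        dist1 (loopHol (Averaging.iter (fun i => blockAvg (P := P) (j := i) (expMeanLogSU (n := Fin N))) i U₀) c idx) ≤ α i := hα i hi
    have hα6 : α i ≤ 1 / 6 := (hα24 i).trans (by norm_num)
    have hsb : SmallBelow (fun i => blockAvg (P := P) (j := i) (expMeanLogSU (n := Fin N))) (i + 1) U₀ := by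
      intro i' hi' c idx
      exact lt_of_le_of_lt (hα i' (lt_of_lt_of_le hi' hik) c idx) (hαδ i')
    -- (D0) + (D1-loc): the level-`i+1` field is `Q₁^{R₀}(V_i)(Y_i)` up to `404ℓα_i·Σ_{blocks(c)}‖Y_i b‖`
    have hstep : ∀ c' : PBond P (i + 1),
        ‖((fderiv ℝ (fun (A : PBond P 0 → (specialUnitaryLogChart (Fin N)).lie) (c' : PBond P (i + 1)) =>
              (isChartRep_specialUnitaryGroup (n := Fin N)).logChart
                (Averaging.iter (fun i => blockAvg (P := P) (j := i) (expMeanLogSU (n := Fin N))) (i + 1)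
                    (fun b => (isChartRep_specialUnitaryGroup (n := Fin N)).expChart (A b) * U₀ b) c' *
                  (Averaging.iter (fun i => blockAvg (P := P) (j := i) (expMeanLogSU (n := Fin N))) (i + 1) U₀ c')⁻¹)) 0 X c' :
              (specialUnitaryLogChart (Fin N)).lie) : Matrix (Fin N) (Fin N) ℂ) -
            covLinAvgR0 (Averaging.iter (fun i => blockAvg (P := P) (j := i) (expMeanLogSU (n := Fin N))) i U₀)
              (fun b => ((fderiv ℝ (fun (A : PBond P 0 → (specialUnitaryLogChart (Fin N)).lie) (c : PBond P i) =>
                  (isChartRep_specialUnitaryGroup (n := Fin N)).logChart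
                    (Averaging.iter (fun i => blockAvg (P := P) (j := i) (expMeanLogSU (n := Fin N))) i
                        (fun b => (isChartRep_specialUnitaryGroup (n := Fin N)).expChart (A b) * U₀ b) c *
                      (Averaging.iter (fun i => blockAvg (P := P) (j := i) (expMeanLogSU (n := Fin N))) i U₀ c)⁻¹)) 0 X b :
                  (specialUnitaryLogChart (Fin N)).lie) : Matrix (Fin N) (Fin N) ℂ)) c'‖ ≤
          404 * ℓ * α i * ∑ b ∈ Finset.univ.filter (fun b : PBond P i => blockOf b.src = c'.src ∨ blockOf b.src = c'.tgt),
            ‖((fderiv ℝ (fun (A : PBond P 0 → (specialUnitaryLogChart (Fin N)).lie) (c : PBond P i) =>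
                  (isChartRep_specialUnitaryGroup (n := Fin N)).logChart
                    (Averaging.iter (fun i => blockAvg (P := P) (j := i) (expMeanLogSU (n := Fin N))) i
                        (fun b => (isChartRep_specialUnitaryGroup (n := Fin N)).expChart (A b) * U₀ b) c *
                      (Averaging.iter (fun i => blockAvg (P := P) (j := i) (expMeanLogSU (n := Fin N))) i U₀ c)⁻¹)) 0 X b :
                  (specialUnitaryLogChart (Fin N)).lie) : Matrix (Fin N) (Fin N) ℂ)‖ := by
      intro c'
      rw [fderiv_chartRead_iter_succ_apply (P := P) (N := N) U₀ i hsb X]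
      refine (norm_fderiv_chartRead_sub_covLinAvgR0_le_local (P := P) (N := N) hi1 _ hαi (hα24 i) (hαδ i) _ c').trans ?_
      rw [hℓ]
      refine mul_le_mul_of_nonneg_left ((norm_truncate_le_sum _ _).trans (le_of_eq (Finset.sum_congr rfl fun b _ => ?_))) (by have := hα0 i; positivity)
      exact (Submodule.norm_coe _).symm
    -- one step in `ℓ¹`
    have hr0 : 0 ≤ 404 * ℓ * α i := by have := hα0 i; positivity
    obtain ⟨M', Φ', hdec', hM', hΦ'⟩ := decomp_step_ell1 (P := P) (N := N) hi1 _ hαi (hαδ i) hα6 (hα0 i) hr0 _ M Φ hdec _ hstep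
    refine ⟨M', Φ', fun b => hdec' b, ?_⟩
    -- the invariant: `m′ + κφ′ ≤ (1 + cα_i)(m + κφ)`
    set m : ℝ := ∑ b : PBond P i, ‖M b‖ with hm
    set φ : ℝ := ∑ x : Site P i, ‖Φ x‖ with hφ
    have hm0 : 0 ≤ m := Finset.sum_nonneg fun _ _ => norm_nonneg _
    have hφ0 : 0 ≤ φ := Finset.sum_nonneg fun _ _ => norm_nonneg _
    have hαi0 := hα0 i
    have hEsucc : E (i + 1) = E i * (1 + c * α i) := by
      show (∏ j ∈ Finset.range (i + 1), (1 + c * α j)) = (∏ j ∈ Finset.range i, (1 + c * α j)) * (1 + c * α i)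
      rw [Finset.prod_range_succ]
    show ∑ b : PBond P (i + 1), ‖M' b‖ + κ * ∑ x : Site P (i + 1), ‖Φ' x‖ ≤ E (i + 1) * x₀
    rw [hEsucc]
    have hM'' : ∑ b : PBond P (i + 1), ‖M' b‖ ≤ (ρ + 12 * D * ℓ * α i + 2 * D * (404 * ℓ * α i)) * m + (6 * D * α i + 4 * D ^ 2 * (404 * ℓ * α i)) * φ := hM'
    have hΦ'' : ∑ y : Site P (i + 1), ‖Φ' y‖ ≤ ℓ * m + φ := hΦ'
    have hS' : m + κ * φ ≤ E i * x₀ := hS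
    -- coefficient comparison
    have hκℓ : κ * ℓ = 1 / 4 := by rw [hκ]; field_simp
    have h1 : (ρ + 12 * D * ℓ * α i + 2 * D * (404 * ℓ * α i)) + κ * ℓ ≤ 1 + c * α i := by
      rw [hκℓ]
      have e1 : 12 * D * ℓ * α i + 2 * D * (404 * ℓ * α i) = (820 * D * ℓ) * α i := by ring
      have hcge : 820 * D * ℓ ≤ c := by
        rw [hc]; have : 0 ≤ 24 * D * ℓ + 6464 * D ^ 2 * ℓ ^ 2 := by positivity
        linarith
      have h3 : (820 * D * ℓ) * α i ≤ c * α i := mul_le_mul_of_nonneg_right hcge hαi0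
      linarith
    have h2 : (6 * D * α i + 4 * D ^ 2 * (404 * ℓ * α i)) + κ ≤ κ * (1 + c * α i) := by
      -- `(6D + 1616D²ℓ)α ≤ κcα` since `κc = (844Dℓ + 6464D²ℓ²)∕(4ℓ) = 211D + 1616D²ℓ`
      have hkc : κ * c = 211 * D + 1616 * D ^ 2 * ℓ := by rw [hκ, hc]; field_simp; ring
      have e1 : 6 * D * α i + 4 * D ^ 2 * (404 * ℓ * α i) = (6 * D + 1616 * D ^ 2 * ℓ) * α i := by ring
      have e2 : κ * (1 + c * α i) = κ + (κ * c) * α i := by ring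
      have hle : 6 * D + 1616 * D ^ 2 * ℓ ≤ κ * c := by rw [hkc]; linarith
      have h3 : (6 * D + 1616 * D ^ 2 * ℓ) * α i ≤ (κ * c) * α i := mul_le_mul_of_nonneg_right hle hαi0
      linarith
    calc ∑ b : PBond P (i + 1), ‖M' b‖ + κ * ∑ x : Site P (i + 1), ‖Φ' x‖
        ≤ ((ρ + 12 * D * ℓ * α i + 2 * D * (404 * ℓ * α i)) * m + (6 * D * α i + 4 * D ^ 2 * (404 * ℓ * α i)) * φ) + κ * (ℓ * m + φ) :=
          add_le_add hM'' (mul_le_mul_of_nonneg_left hΦ'' hκ0.le)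
      _ = ((ρ + 12 * D * ℓ * α i + 2 * D * (404 * ℓ * α i)) + κ * ℓ) * m + ((6 * D * α i + 4 * D ^ 2 * (404 * ℓ * α i)) + κ) * φ := by ring
      _ ≤ (1 + c * α i) * m + (κ * (1 + c * α i)) * φ := add_le_add (mul_le_mul_of_nonneg_right h1 hm0) (mul_le_mul_of_nonneg_right h2 hφ0)
      _ = (1 + c * α i) * (m + κ * φ) := by ring
      _ ≤ (1 + c * α i) * (E i * x₀) := mul_le_mul_of_nonneg_left hS' (by positivity)
      _ = E i * (1 + c * α i) * x₀ := by ring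

end Bootstrap

/-! ## §5 ★★★ (D2-ℓ¹): the k-step `ℓ¹` bound — no `L^k` -/

section KStep

/-- ★★★ **(D2-ℓ¹) «WHAT `DM` DOES, k STEPS, IN `ℓ¹` OVER BONDS»**: `2 ≤ d`, `k ≤ m + K`, loop `α_i`-guards at every level `i < k` (`0 ≤ α_i ≤ 1∕24`, `α_i < δ_N`); then for
every chart direction `X`:
`Σ_B ‖↑((DΨ_k(0) X) B)‖ ≤ (1 + 8d(d+2)L)·Π_{i<k}(1 + (844d(d+2)L + 6464d²((d+2)L)²)·α_i)·Σ_b ‖↑(X b)‖` — NO `L^k`, no volume factor; with `Σα_i ≤ 1` the constant is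
independent of `k`. [cite: Balaban1985Averaging, Prop. 3-4 pp.36-37, (139)-(147) pp.39-40; Balaban1987RG1, (0.11) p.253] -/
theorem sum_norm_fderiv_chartRead_iter_le (hd : 2 ≤ P.d) (U₀ : GaugeField P 0 (SU N)) (X : PBond P 0 → (specialUnitaryLogChart (Fin N)).lie) {α : ℕ → ℝ}
    (hα0 : ∀ i, 0 ≤ α i) (hα24 : ∀ i, α i ≤ 1 / 24) (hαδ : ∀ i, α i < deltaSU (Fin N)) (k : ℕ) (hk : k ≤ P.m + P.K)
    (hα : ∀ i, i < k → ∀ (c : PBond P (i + 1)) (idx : Idx P),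
      dist1 (loopHol (Averaging.iter (fun i => blockAvg (P := P) (j := i) (expMeanLogSU (n := Fin N))) i U₀) c idx) ≤ α i) :
    ∑ B : PBond P k, ‖((fderiv ℝ (fun (A : PBond P 0 → (specialUnitaryLogChart (Fin N)).lie) (c : PBond P k) =>
          (isChartRep_specialUnitaryGroup (n := Fin N)).logChart
            (Averaging.iter (fun i => blockAvg (P := P) (j := i) (expMeanLogSU (n := Fin N))) k
                (fun b => (isChartRep_specialUnitaryGroup (n := Fin N)).expChart (A b) * U₀ b) c *
              (Averaging.iter (fun i => blockAvg (P := P) (j := i) (expMeanLogSU (n := Fin N))) k U₀ c)⁻¹)) 0 X B :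
          (specialUnitaryLogChart (Fin N)).lie) : Matrix (Fin N) (Fin N) ℂ)‖ ≤
      (1 + 8 * (P.d : ℝ) * (((P.d + 2) * P.L : ℕ) : ℝ)) *
        (∏ j ∈ Finset.range k, (1 + (844 * (P.d : ℝ) * (((P.d + 2) * P.L : ℕ) : ℝ) + 6464 * (P.d : ℝ) ^ 2 * (((P.d + 2) * P.L : ℕ) : ℝ) ^ 2) * α j)) *
        ∑ b : PBond P 0, ‖((X b : (specialUnitaryLogChart (Fin N)).lie) : Matrix (Fin N) (Fin N) ℂ)‖ := by
  obtain ⟨M, Φ, hdec, hS⟩ := exists_decomp_fderiv_chartRead_iter_ell1 (P := P) (N := N) hd U₀ X hα0 hα24 hαδ k hk hα k le_rfl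
  set ℓ : ℝ := (((P.d + 2) * P.L : ℕ) : ℝ) with hℓ
  have hℓ1 : (1 : ℝ) ≤ ℓ := by
    rw [hℓ]; have h2 : 2 ≤ P.L := P.hL.2; push_cast; nlinarith [show (2:ℝ) ≤ P.L by exact_mod_cast h2, show (2:ℝ) ≤ P.d by exact_mod_cast hd]
  have hℓ0 : 0 < ℓ := by linarith
  have hY := sum_norm_le_of_decomp (Averaging.iter (fun i => blockAvg (P := P) (j := i) (expMeanLogSU (n := Fin N))) k U₀) _ M Φ hdec
  set m : ℝ := ∑ b : PBond P k, ‖M b‖ with hm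
  set φ : ℝ := ∑ x : Site P k, ‖Φ x‖ with hφ
  have hm0 : 0 ≤ m := Finset.sum_nonneg fun _ _ => norm_nonneg _
  have hφ0 : 0 ≤ φ := Finset.sum_nonneg fun _ _ => norm_nonneg _
  have hS' : m + (1 / (4 * ℓ)) * φ ≤ _ := hS
  -- `m + 2dφ ≤ (1 + 8dℓ)(m + φ∕(4ℓ))`
  have hD0 : (0 : ℝ) ≤ (P.d : ℝ) := Nat.cast_nonneg _
  have key : m + 2 * (P.d : ℝ) * φ ≤ (1 + 8 * (P.d : ℝ) * ℓ) * (m + (1 / (4 * ℓ)) * φ) := by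
    have e : (1 + 8 * (P.d : ℝ) * ℓ) * (m + (1 / (4 * ℓ)) * φ) = m + 2 * (P.d : ℝ) * φ + (8 * (P.d : ℝ) * ℓ * m + (1 / (4 * ℓ)) * φ) := by
      field_simp; ring
    rw [e]
    have : 0 ≤ 8 * (P.d : ℝ) * ℓ * m + (1 / (4 * ℓ)) * φ := by positivity
    linarith
  have hA : (0 : ℝ) ≤ 1 + 8 * (P.d : ℝ) * ℓ := by positivity
  refine hY.trans (key.trans ?_)
  calc (1 + 8 * (P.d : ℝ) * ℓ) * (m + (1 / (4 * ℓ)) * φ) ≤ (1 + 8 * (P.d : ℝ) * ℓ) * _ := mul_le_mul_of_nonneg_left hS' hA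
    _ = _ := by ring

/-- ★★★ **(D2-ℓ¹), EXPONENTIAL FORM**: `Σ_B ‖↑((DΨ_k(0) X) B)‖ ≤ (1 + 8d(d+2)L)·exp((844d(d+2)L + 6464d²((d+2)L)²)·Σ_{i<k}α_i)·Σ_b ‖↑(X b)‖`.
[cite: Balaban1985Averaging, (147) p.40; Balaban1987RG1, (0.11) p.253] -/
theorem sum_norm_fderiv_chartRead_iter_le_exp (hd : 2 ≤ P.d) (U₀ : GaugeField P 0 (SU N)) (X : PBond P 0 → (specialUnitaryLogChart (Fin N)).lie) {α : ℕ → ℝ}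
    (hα0 : ∀ i, 0 ≤ α i) (hα24 : ∀ i, α i ≤ 1 / 24) (hαδ : ∀ i, α i < deltaSU (Fin N)) (k : ℕ) (hk : k ≤ P.m + P.K)
    (hα : ∀ i, i < k → ∀ (c : PBond P (i + 1)) (idx : Idx P),
      dist1 (loopHol (Averaging.iter (fun i => blockAvg (P := P) (j := i) (expMeanLogSU (n := Fin N))) i U₀) c idx) ≤ α i) :
    ∑ B : PBond P k, ‖((fderiv ℝ (fun (A : PBond P 0 → (specialUnitaryLogChart (Fin N)).lie) (c : PBond P k) =>
          (isChartRep_specialUnitaryGroup (n := Fin N)).logChart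
            (Averaging.iter (fun i => blockAvg (P := P) (j := i) (expMeanLogSU (n := Fin N))) k
                (fun b => (isChartRep_specialUnitaryGroup (n := Fin N)).expChart (A b) * U₀ b) c *
              (Averaging.iter (fun i => blockAvg (P := P) (j := i) (expMeanLogSU (n := Fin N))) k U₀ c)⁻¹)) 0 X B :
          (specialUnitaryLogChart (Fin N)).lie) : Matrix (Fin N) (Fin N) ℂ)‖ ≤
      (1 + 8 * (P.d : ℝ) * (((P.d + 2) * P.L : ℕ) : ℝ)) *
        Real.exp ((844 * (P.d : ℝ) * (((P.d + 2) * P.L : ℕ) : ℝ) + 6464 * (P.d : ℝ) ^ 2 * (((P.d + 2) * P.L : ℕ) : ℝ) ^ 2) * ∑ j ∈ Finset.range k, α j) *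
        ∑ b : PBond P 0, ‖((X b : (specialUnitaryLogChart (Fin N)).lie) : Matrix (Fin N) (Fin N) ℂ)‖ := by
  have hc : (0 : ℝ) ≤ 844 * (P.d : ℝ) * (((P.d + 2) * P.L : ℕ) : ℝ) + 6464 * (P.d : ℝ) ^ 2 * (((P.d + 2) * P.L : ℕ) : ℝ) ^ 2 := by positivity
  refine (sum_norm_fderiv_chartRead_iter_le (P := P) (N := N) hd U₀ X hα0 hα24 hαδ k hk hα).trans ?_
  have hprod := prod_one_add_le_exp_sum hc hα0 k
  have h0 : 0 ≤ ∑ b : PBond P 0, ‖((X b : (specialUnitaryLogChart (Fin N)).lie) : Matrix (Fin N) (Fin N) ℂ)‖ := Finset.sum_nonneg fun _ _ => norm_nonneg _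
  have hA : (0 : ℝ) ≤ 1 + 8 * (P.d : ℝ) * (((P.d + 2) * P.L : ℕ) : ℝ) := by positivity
  exact mul_le_mul_of_nonneg_right (mul_le_mul_of_nonneg_left hprod hA) h0

end KStep

end Summit.QuantumFields.YangMills.Theorems.FluctuationComparisonRegPrIntLS2BetaChartReadDerivKStepEllOneTower

end
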